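import Summits.HodgeConjecture.CorCM.Census.QuarticTwistReduction

/-!
# The quartic twist `(ℤ/4 × B, (2,0))`, IV: the RESIDUAL STRUCTURE — a Hodge vector supported on the small residual types is a
# combination of pairs, the Boolean pair differences `X_{u,b}` and the Weil vectors `w_u`

COR-CM (cell `pub-hodgecm2`), count-neutral kernel combinatorics by the binder seat b09 (gen 32; lane QUARTIC-TWIST), part IV, sequel of
`Census/QuarticTwistReduction.lean`.  Theorems + three bookkeeping definitions (`chi`, `Xvec`, `Wvec`); no `decide` table, no certificate,
no named fact, no geometry, no `sorry`.  HONEST FRAMING: `HC_CM` is NOT proved; nothing here is a headline or a period.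
This file holds §1–§2 (atoms, `X`, `w`, the form difference, constant-supported Hodge vectors); the elimination §3 is the sequel
`Census/QuarticTwistResidualStructure.lean`.

THE STRUCTURE THEOREM (`|B| ≥ 3`, any parity).  Put `X_{u,b} = e_{u+δ_b} + e_{(u+1)−δ_b} − e_u − e_{u+1}` (a difference of two PAIRS of
the complemented index-two subgroup `⟨c⟩ × B`, NOT a pair of `G`) and `w_u = Σ_b e_{u−δ_b} − (|B|−1)·e_u − e_{u−1}` (the Weil vector of
the regime `u`).  Both are Hodge vectors (`Xvec_mem`, `Wvec_mem`).  **`residual_mem`**: every Hodge vector supported on the small residual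
types `u`, `u ± δ_b` lies in any submodule containing the pairs, all `X_{u,b}` and all `w_u` — so modulo pairs the residual Hodge
lattice is spanned by the `2|B| + 2` vectors `X_{0,b}, X_{1,b}, w_0, w_1` (the corank `8, 12, 16` for `|B| = 3, 5, 7` measured in the seat
note).  PROOF (explicit elimination, §3): kill the `(+1)`-atoms with the `X`'s, the `(−1)`-atoms of regimes `2, 3` with pairs, the
`(−1)`-atoms of regimes `0, 1` at a base column `b₀` with `w_0, w_1`; then the DIFFERENCE of the Pohlmann forms at `(a, t)` and `(a, b₀)`
sees only the `(−1)`-atoms at the columns `t, b₀` (§2 `form_diff`) and forces the remaining `(−1)`-atoms to vanish; a Hodge vector on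
the four constant types is a sum of pairs (`mem_pairs_of_cst`).  §1: atoms are injective in `(u, b, k)` for `k ≠ 0` once `|B| ≥ 3`.
All [folklore].

## References
* [Pohlmann1968] H. Pohlmann, Algebraic cycles on abelian varieties of complex multiplication type, Ann. of Math. 88 (1968), Thm 1.
-/

namespace Summit.HodgeConjecture.CorCM.Census.QuarticTwist

open Finset

variable (B : Type) [AddGroup B] [Fintype B] [DecidableEq B]

/-! ## §1 Atoms: values of the forms, injectivity -/

/-- The value of a Pohlmann form at a column value: `χ a x = +1` iff `x ∈ {a, a−1}`. [folklore] -/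
def chi (a x : ZMod 4) : ℤ := if a = x ∨ a = x + 1 then 1 else -1

omit [AddGroup B] [Fintype B] [DecidableEq B] in
/-- The form of `(a, t)` at `s` is `χ a (s t)`. [folklore] -/
theorem coef_eq_chi (a : ZMod 4) (t : B) (s : Ty B) : coef B (a, t) s = chi a (s t) := rfl

omit [AddGroup B] [Fintype B] in
/-- The form of `(a, t)` at an atom. [folklore] -/
theorem coef_atom (a : ZMod 4) (t : B) (u : ZMod 4) (b : B) (k : ZMod 4) :
    coef B (a, t) (atom B u b k) = if t = b then chi a (u + k) else chi a u := by
  rw [coef_eq_chi, atom_apply]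
  split_ifs <;> rfl

omit [AddGroup B] [Fintype B] [DecidableEq B] in
/-- The form of `(a, t)` at a constant type. [folklore] -/
theorem coef_cst (a : ZMod 4) (t : B) (u : ZMod 4) : coef B (a, t) (cst B u) = chi a u := rfl

omit [AddGroup B] in
/-- Two columns are distinct from a third one (`|B| ≥ 3`). [folklore] -/
theorem exists_ne_ne (h3 : 3 ≤ Fintype.card B) (b b' : B) : ∃ x : B, x ≠ b ∧ x ≠ b' := by
  have hlt : ({b, b'} : Finset B).card < (univ : Finset B).card := by
    rw [Finset.card_univ]
    exact lt_of_lt_of_le (lt_of_le_of_lt (Finset.card_insert_le _ _) (by rw [card_singleton]; omega)) h3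
  obtain ⟨x, -, hx⟩ := Finset.exists_mem_notMem_of_card_lt_card hlt
  simp only [mem_insert, mem_singleton, not_or] at hx
  exact ⟨x, hx.1, hx.2⟩

omit [AddGroup B] in
/-- **Atoms with a defect are injective in `(u, b, k)`** (`|B| ≥ 3`). [folklore] -/
theorem atom_eq_atom_iff (h3 : 3 ≤ Fintype.card B) {u u' : ZMod 4} {b b' : B} {k k' : ZMod 4} (hk : k ≠ 0) :
    atom B u b k = atom B u' b' k' ↔ u = u' ∧ b = b' ∧ k = k' := by
  constructor
  · intro h
    obtain ⟨x, hxb, hxb'⟩ := exists_ne_ne B h3 b b'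
    have hu : u = u' := by
      have := congrFun h x
      rwa [atom_apply, atom_apply, if_neg hxb, if_neg hxb'] at this
    subst hu
    have hb : b = b' := by
      by_contra hbb
      have := congrFun h b
      rw [atom_apply, atom_apply, if_pos rfl, if_neg hbb] at this
      exact hk (by simpa using this)
    subst hb
    have := congrFun h b
    rw [atom_apply, atom_apply, if_pos rfl, if_pos rfl] at this
    exact ⟨rfl, rfl, add_left_cancel this⟩
  · rintro ⟨rfl, rfl, rfl⟩; rfl

omit [AddGroup B] in
/-- An atom with a defect is not a constant type (`|B| ≥ 3`). [folklore] -/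
theorem atom_ne_cst (h3 : 3 ≤ Fintype.card B) {u : ZMod 4} {b : B} {k : ZMod 4} (hk : k ≠ 0) (u' : ZMod 4) :
    atom B u b k ≠ cst B u' := by
  intro h
  obtain ⟨x, hxb, -⟩ := exists_ne_ne B h3 b b
  have h1 := congrFun h x
  have h2 := congrFun h b
  rw [atom_apply, if_neg hxb] at h1
  rw [atom_apply, if_pos rfl] at h2
  change u = u' at h1
  change u + k = u' at h2
  exact hk (by rw [← h1] at h2; simpa using h2)

omit [AddGroup B] [Fintype B] [DecidableEq B] in
/-- Constant types are injective in `u` (`B` nonempty). [folklore] -/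
theorem cst_eq_cst_iff (b₀ : B) {u u' : ZMod 4} : cst B u = cst B u' ↔ u = u' :=
  ⟨fun h => congrFun h b₀, fun h => by rw [h]⟩

omit [AddGroup B] in
/-- A unit vector at an atom evaluated at an atom (`k, k' ≠ 0`, `|B| ≥ 3`). [folklore] -/
theorem single_atom_apply_atom (h3 : 3 ≤ Fintype.card B) {u u' : ZMod 4} {b b' : B} {k k' : ZMod 4} (hk : k ≠ 0) (c : ℤ) :
    (Pi.single (atom B u b k) c : Ty B → ℤ) (atom B u' b' k') = if u = u' ∧ b = b' ∧ k = k' then c else 0 := by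
  rw [Pi.single_apply]
  by_cases h : u = u' ∧ b = b' ∧ k = k'
  · obtain ⟨rfl, rfl, rfl⟩ := h
    rw [if_pos rfl, if_pos ⟨rfl, rfl, rfl⟩]
  · rw [if_neg h, if_neg (fun h' => h ((atom_eq_atom_iff B h3 hk).mp h'.symm))]

omit [AddGroup B] in
/-- A unit vector at a constant type vanishes at an atom with a defect (`|B| ≥ 3`). [folklore] -/
theorem single_cst_apply_atom (h3 : 3 ≤ Fintype.card B) (u u' : ZMod 4) {b' : B} {k' : ZMod 4} (hk : k' ≠ 0) (c : ℤ) :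
    (Pi.single (cst B u) c : Ty B → ℤ) (atom B u' b' k') = 0 := by
  rw [Pi.single_apply, if_neg (atom_ne_cst B h3 hk u)]

omit [AddGroup B] in
/-- A unit vector at an atom with a defect vanishes at a constant type (`|B| ≥ 3`). [folklore] -/
theorem single_atom_apply_cst (h3 : 3 ≤ Fintype.card B) (u u' : ZMod 4) {b : B} {k : ZMod 4} (hk : k ≠ 0) (c : ℤ) :
    (Pi.single (atom B u b k) c : Ty B → ℤ) (cst B u') = 0 := by
  rw [Pi.single_apply, if_neg (fun h => atom_ne_cst B h3 hk u' h.symm)]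

/-! ## §2 The vectors `X_{u,b}`, `w_u`; the difference of two forms on a residual vector -/

/-- **The Boolean pair difference** `X_{u,b} = e_{u+δ_b} + e_{(u+1)−δ_b} − e_u − e_{u+1}`. [folklore] -/
def Xvec (u : ZMod 4) (b : B) : Ty B → ℤ :=
  Pi.single (atom B u b 1) 1 + Pi.single (atom B (u + 1) b (-1)) 1 - Pi.single (cst B u) 1 - Pi.single (cst B (u + 1)) 1

/-- **The Weil vector of the regime `u`**: `w_u = Σ_b e_{u−δ_b} − (|B|−1)·e_u − e_{u−1}`. [folklore] -/
def Wvec (u : ZMod 4) : Ty B → ℤ :=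
  ∑ b, Pi.single (atom B u b (-1)) 1 - ((Fintype.card B : ℤ) - 1) • Pi.single (cst B u) 1 - Pi.single (cst B (u - 1)) 1

/-- `χ a (u + 1 − 1) = χ a u` bookkeeping and the two values seen by `X`. [folklore] -/
theorem chi_X (a u : ZMod 4) : chi a (u + 1) + chi a (u + 1 + -1) - chi a u - chi a (u + 1) = 0 := by
  rw [show u + 1 + -1 = u by ring]; ring

omit [AddGroup B] in
/-- **`X_{u,b}` is a Hodge vector.** [folklore] -/
theorem Xvec_mem (u : ZMod 4) (b : B) : Xvec B u b ∈ hodge B := by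
  rintro ⟨a, t⟩
  unfold Xvec
  rw [dotProduct_sub, dotProduct_sub, dotProduct_add, dotProduct_single, dotProduct_single, dotProduct_single, dotProduct_single,
    coef_atom, coef_atom, coef_cst, coef_cst, mul_one, mul_one, mul_one, mul_one]
  by_cases ht : t = b
  · rw [if_pos ht, if_pos ht]; exact chi_X a u
  · rw [if_neg ht, if_neg ht]; ring

omit [AddGroup B] in
/-- The form of `(a, t)` on `Σ_b e_{u−δ_b}`: `χ a (u−1) + (|B|−1)·χ a u`. [folklore] -/
theorem coef_dotProduct_sum_minus (a : ZMod 4) (t : B) (u : ZMod 4) :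
    coef B (a, t) ⬝ᵥ (∑ b, Pi.single (atom B u b (-1)) (1 : ℤ)) = chi a (u + -1) + ((Fintype.card B : ℤ) - 1) * chi a u := by
  rw [dotProduct_sum]
  have h : ∀ b, coef B (a, t) ⬝ᵥ Pi.single (atom B u b (-1)) (1 : ℤ) = chi a u + (if t = b then chi a (u + -1) - chi a u else 0) := by
    intro b
    rw [dotProduct_single, coef_atom, mul_one]
    split_ifs <;> ring
  rw [Finset.sum_congr rfl (fun b _ => h b), Finset.sum_add_distrib, Finset.sum_const, Finset.card_univ, Finset.sum_ite_eq,
    if_pos (mem_univ t), nsmul_eq_mul]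
  ring

omit [AddGroup B] in
/-- **`w_u` is a Hodge vector.** [folklore] -/
theorem Wvec_mem (u : ZMod 4) : Wvec B u ∈ hodge B := by
  rintro ⟨a, t⟩
  unfold Wvec
  rw [dotProduct_sub, dotProduct_sub, dotProduct_smul, coef_dotProduct_sum_minus, dotProduct_single, dotProduct_single, coef_cst,
    coef_cst, mul_one, mul_one, smul_eq_mul, show u - 1 = u + -1 by ring]
  ring

omit [AddGroup B] in
/-- **The difference of the forms at `(a, t)` and `(a, t')`** on a vector `r` supported on the small residual types and vanishing on the
`(+1)`-atoms sees only the `(−1)`-atoms at the columns `t` and `t'`: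
`F_{a,t}(r) − F_{a,t'}(r) = 2·[(r((a+1)−δ_t) − r((a+1)−δ_{t'})) − (r((a−1)−δ_t) − r((a−1)−δ_{t'}))]` (`|B| ≥ 3`). [folklore] -/
theorem form_diff (h3 : 3 ≤ Fintype.card B) {r : Ty B → ℤ} (hsupp : ∀ s, r s ≠ 0 → IsRes1 B s)
    (hplus : ∀ (u : ZMod 4) (b : B), r (atom B u b 1) = 0) (a : ZMod 4) {t t' : B} (htt : t ≠ t') :
    coef B (a, t) ⬝ᵥ r - coef B (a, t') ⬝ᵥ r =
      2 * ((r (atom B (a + 1) t (-1)) - r (atom B (a + 1) t' (-1))) - (r (atom B (a - 1) t (-1)) - r (atom B (a - 1) t' (-1)))) := by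
  classical
  have hm1 : (-1 : ZMod 4) ≠ 0 := by decide
  -- the difference as one sum, supported on the `(−1)`-atoms at `t` and `t'`
  have hdiff : coef B (a, t) ⬝ᵥ r - coef B (a, t') ⬝ᵥ r = ∑ s, (coef B (a, t) s - coef B (a, t') s) * r s := by
    unfold dotProduct; rw [← Finset.sum_sub_distrib]; refine Finset.sum_congr rfl fun s _ => by ring
  set f : Ty B → ℤ := fun s => (coef B (a, t) s - coef B (a, t') s) * r s with hf
  set S : Finset (Ty B) := (univ.image fun u : ZMod 4 => atom B u t (-1)) ∪ (univ.image fun u : ZMod 4 => atom B u t' (-1)) with hS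
  have hzero : ∀ s, s ∉ S → f s = 0 := by
    intro s hs
    by_cases hr : r s = 0
    · simp only [hf, hr, mul_zero]
    · obtain ⟨u, b, k, hk, rfl⟩ := hsupp s hr
      rcases hk with rfl | rfl | rfl
      · simp only [hf, atom_zero, coef_cst, sub_self, zero_mul]
      · simp only [hf, hplus, mul_zero]
      · -- a `(−1)`-atom outside `S` sits at a column `b ∉ {t, t'}`
        have hbt : b ≠ t := by
          rintro rfl; exact hs (mem_union_left _ (mem_image_of_mem _ (mem_univ u)))
        have hbt' : b ≠ t' := by
          rintro rfl; exact hs (mem_union_right _ (mem_image_of_mem _ (mem_univ u)))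
        simp only [hf, coef_atom, if_neg (Ne.symm hbt), if_neg (Ne.symm hbt'), sub_self, zero_mul]
  have hsum : ∑ s, f s = ∑ s ∈ S, f s := by
    rw [← Finset.sum_subset (subset_univ S) (fun s _ hs => hzero s hs)]
  have hdisj : Disjoint (univ.image fun u : ZMod 4 => atom B u t (-1)) (univ.image fun u : ZMod 4 => atom B u t' (-1)) := by
    rw [Finset.disjoint_left]
    intro s hs hs'
    obtain ⟨u, -, rfl⟩ := mem_image.mp hs
    obtain ⟨u', -, h⟩ := mem_image.mp hs'
    exact htt ((atom_eq_atom_iff B h3 hm1).mp h).2.1.symm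
  have hinj : ∀ c : B, Set.InjOn (fun u : ZMod 4 => atom B u c (-1)) ↑(univ : Finset (ZMod 4)) := by
    intro c u _ u' _ h
    exact ((atom_eq_atom_iff B h3 hm1).mp h).1
  rw [hdiff, show (∑ s, (coef B (a, t) s - coef B (a, t') s) * r s) = ∑ s, f s from rfl, hsum, hS, Finset.sum_union hdisj,
    Finset.sum_image (hinj t), Finset.sum_image (hinj t')]
  -- evaluate the two four-term sums
  have ht : ∀ u : ZMod 4, f (atom B u t (-1)) = (chi a (u + -1) - chi a u) * r (atom B u t (-1)) := by
    intro u; simp only [hf, coef_atom, if_true, Ne.symm htt, if_false]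
  have ht' : ∀ u : ZMod 4, f (atom B u t' (-1)) = (chi a u - chi a (u + -1)) * r (atom B u t' (-1)) := by
    intro u; simp only [hf, coef_atom, htt, if_false, if_true]
  have hchi : ∀ a u : ZMod 4, chi a (u + -1) - chi a u = (if u = a + 1 then 2 else 0) - (if u = a - 1 then 2 else 0) := by decide
  simp only [ht, ht', hchi]
  have e1 : ∀ (g : ZMod 4 → ℤ), ∑ u : ZMod 4, ((if u = a + 1 then (2 : ℤ) else 0) - (if u = a - 1 then 2 else 0)) * g u
      = 2 * g (a + 1) - 2 * g (a - 1) := by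
    intro g
    have h2 : ∀ u, ((if u = a + 1 then (2 : ℤ) else 0) - (if u = a - 1 then 2 else 0)) * g u
        = (if u = a + 1 then 2 * g u else 0) - (if u = a - 1 then 2 * g u else 0) := by
      intro u; split_ifs <;> ring
    simp only [h2, Finset.sum_sub_distrib, Finset.sum_ite_eq', mem_univ, if_true]
  have e2 : ∀ (g : ZMod 4 → ℤ), ∑ u : ZMod 4, (-((if u = a + 1 then (2 : ℤ) else 0) - (if u = a - 1 then 2 else 0))) * g u
      = -(2 * g (a + 1) - 2 * g (a - 1)) := by
    intro g
    rw [← e1 g, ← Finset.sum_neg_distrib]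
    refine Finset.sum_congr rfl fun u _ => by ring
  have hneg : ∀ u : ZMod 4, (chi a u - chi a (u + -1)) = -(chi a (u + -1) - chi a u) := fun u => by ring
  rw [e1 (fun u => r (atom B u t (-1)))]
  have : ∑ u : ZMod 4, (chi a u - chi a (u + -1)) * r (atom B u t' (-1)) = -(2 * r (atom B (a + 1) t' (-1)) - 2 * r (atom B (a - 1) t' (-1))) := by
    rw [← e2 (fun u => r (atom B u t' (-1)))]
    refine Finset.sum_congr rfl fun u _ => ?_
    rw [hneg, hchi]
  rw [this]
  ring

omit [AddGroup B] in
/-- **A Hodge vector supported on the constant types is a sum of pairs.** [folklore] -/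
theorem mem_pairs_of_cst (b₀ : B) {r : Ty B → ℤ} (hr : r ∈ hodge B) (hsupp : ∀ s, r s ≠ 0 → ∃ u, s = cst B u) : r ∈ pairs B := by
  classical
  have hinj : Set.InjOn (fun u : ZMod 4 => cst B u) ↑(univ : Finset (ZMod 4)) := fun u _ u' _ h => (cst_eq_cst_iff B b₀).mp h
  -- the forms at `(a, b₀)` restricted to the support
  have hform : ∀ a : ZMod 4, ∑ u : ZMod 4, chi a u * r (cst B u) = 0 := by
    intro a
    have h := hr (a, b₀)
    unfold dotProduct at h
    rw [← Finset.sum_subset (subset_univ (univ.image fun u : ZMod 4 => cst B u)), Finset.sum_image hinj] at h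
    · exact h
    · intro s _ hs
      have hz : r s = 0 := by
        by_contra hne
        obtain ⟨u, rfl⟩ := hsupp s hne
        exact hs (mem_image_of_mem _ (mem_univ u))
      rw [hz, mul_zero]
  have hsum4 : ∀ g : ZMod 4 → ℤ, ∑ u : ZMod 4, g u = g 0 + g 1 + g 2 + g 3 := fun g => Fin.sum_univ_four g
  have h0 := hform 0
  have h1 := hform 1
  rw [hsum4] at h0 h1
  have c00 : chi 0 0 = 1 := by decide
  have c01 : chi 0 1 = -1 := by decide
  have c02 : chi 0 2 = -1 := by decide
  have c03 : chi 0 3 = 1 := by decide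
  have c10 : chi 1 0 = 1 := by decide
  have c11 : chi 1 1 = 1 := by decide
  have c12 : chi 1 2 = -1 := by decide
  have c13 : chi 1 3 = -1 := by decide
  rw [c00, c01, c02, c03] at h0
  rw [c10, c11, c12, c13] at h1
  have e02 : r (cst B 2) = r (cst B 0) := by linarith
  have e13 : r (cst B 3) = r (cst B 1) := by linarith
  have z4 : ((0 : ZMod 4) ≠ 1 ∧ (0 : ZMod 4) ≠ 2 ∧ (0 : ZMod 4) ≠ 3 ∧ (1 : ZMod 4) ≠ 0 ∧ (1 : ZMod 4) ≠ 2 ∧ (1 : ZMod 4) ≠ 3) ∧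
      ((2 : ZMod 4) ≠ 0 ∧ (2 : ZMod 4) ≠ 1 ∧ (2 : ZMod 4) ≠ 3 ∧ (3 : ZMod 4) ≠ 0 ∧ (3 : ZMod 4) ≠ 1 ∧ (3 : ZMod 4) ≠ 2) := by decide
  have key : ∀ u : ZMod 4, u = 0 ∨ u = 1 ∨ u = 2 ∨ u = 3 := by decide
  have hr2 : r = r (cst B 0) • pairVec B (cst B 0) + r (cst B 1) • pairVec B (cst B 1) := by
    funext s
    unfold pairVec
    rw [cst_add_two, cst_add_two, show (0 : ZMod 4) + 2 = 2 by decide, show (1 : ZMod 4) + 2 = 3 by decide]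
    simp only [Pi.add_apply, Pi.smul_apply, Pi.single_apply, smul_eq_mul]
    by_cases hc : ∃ u, s = cst B u
    · obtain ⟨u, rfl⟩ := hc
      simp only [cst_eq_cst_iff B b₀]
      rcases key u with rfl | rfl | rfl | rfl <;> simp [z4, e02, e13]
    · have hs : r s = 0 := by
        by_contra h
        exact hc (hsupp s h)
      have hne : ∀ u : ZMod 4, s ≠ cst B u := fun u h => hc ⟨u, h⟩
      simp [hs, hne]
  rw [hr2]
  exact Submodule.add_mem _ (Submodule.smul_mem _ _ (pairVec_mem_pairs B _)) (Submodule.smul_mem _ _ (pairVec_mem_pairs B _))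

end Summit.HodgeConjecture.CorCM.Census.QuarticTwist
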